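import Summits.CriticalPhenomena.CardyFormulaZ2.Theorems.CardySelfDualSegmentUniformBoxCrossingStubRender
import Summits.CriticalPhenomena.CardyFormulaZ2.Theorems.CardySelfDualSegmentUniformBoxCrossingStubUpper
import HarnessLib

/-!
# Sub-goal `stub_pointwiseRender` of line `Sketch` (crux `UniformMarginality`, stmt-CriticalPhenomena-5472):
# pointwise lattice lower bounds ⇒ the box-crossing property of `M_t` drawn on `√2 ℤ²`

For a *fixed* `t ∈ [0, 1]`, lower bounds `c ≤ M_t(LR([0, M] × [0, N]))` for the left–right
crossings of lattice rectangles of every bounded aspect ratio (`N ≥ n₀`, `M ≤ k N`) give the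
box-crossing property `HasBoxCrossingProperty (cornerPercolation t) squareLatticeEmbedding.z` of the
corner percolation model `M_t = cornerPercolation t`, drawn isoradially as `√2 ℤ²`. This is the
single-`t` specialisation of the two uniform-in-`t` steps of the box-crossing engine of crux
`UniformBoxCrossing` (stmt-CriticalPhenomena-5476), whose proofs never use the uniformity:

* `pointwise_upper` — lower bounds at every aspect ratio ⇒ upper bounds
  `M_t(LR([0, M] × [0, N])) ≤ 1 - c` for `M ≥ n₀`, `N ≤ k M`, by the exact self-duality identity
  `cornerPercolation_real_lrCrossing_add t m N : M_t(LR(m + 1, N)) + M_t(LR(N + 1, m)) = 1`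
  (copy of `stub_upper` with `t` fixed; Bollobás–Riordan 2006, Ch. 3, Cor. 3(i), for `P_{1/2}`);
* `pointwise_embRectCrossing_bounds` — two-sided lattice bounds ⇒ two-sided bounds for the
  embedded horizontal crossings of `w + [0, ρ n] × [0, n]` drawn on `√2 ℤ²`, for all translations
  `w` (copy of `cornerPercolation_embRectCrossing_bounds` with `t` fixed: the sandwich
  `cornerPercolation_real_lrCrossing_le_real_embRectCrossing`,
  `cornerPercolation_real_embRectCrossing_le_real_lrCrossing` and the floor/ceil bookkeeping of
  `square_embRectCrossing_bounds`, Grimmett–Manolescu 2014, §2.3);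
* `stub_pointwiseRender` — the registered stub: vertical crossings are horizontal crossings of the
  transposed picture (`cornerPercolation_real_embTBCrossing_eq_real_embRectCrossing`), as in
  `stub_render`.
-/

noncomputable section

open Set Filter Metric MeasureTheory Complex
open scoped Topology
open Literature.Probability.RandomPlanarGeometry Literature.Probability.Percolation
open Literature.Probability.LatticeModels
open Summit.CriticalPhenomena.CardyFormulaZ2.Cruxes.UniformBoxCrossing.NonSlantLine

namespace Summit.CriticalPhenomena.CardyFormulaZ2.Cruxes.UniformMarginality.HeatFlow

/-- **Upper bounds by self-duality, for a fixed `t`.** Lower bounds at every bounded aspect ratio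
give upper bounds at every bounded inverse aspect ratio:
`M_t(LR([0, m + 1] × [0, n])) = 1 - M_t(LR([0, n + 1] × [0, m]))`
(`cornerPercolation_real_lrCrossing_add`, the planar dual of `M_t` is its point reflection).
Apply the hypothesis at aspect ratio `k + 2`; for `M = m + 1 ≥ n₀ + k + 2` and `N ≤ k M` one has
`m ≥ n₀` and `N + 1 ≤ (k + 2) m`, so `c ≤ M_t(LR(N + 1, m)) = 1 - M_t(LR(m + 1, N))`.
Pointwise copy of `stub_upper`. (Bollobás–Riordan 2006, Ch. 3, Cor. 3(i), for `P_{1/2}`.)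
[folklore] -/
theorem pointwise_upper (t : unitInterval)
    (hLB : ∀ k : ℕ, ∃ c : ℝ, 0 < c ∧ ∃ n₀ : ℕ, ∀ M N : ℕ, n₀ ≤ N →
      M ≤ k * N → c ≤ (cornerPercolation t).real (lrCrossing M N)) :
    ∀ k : ℕ, ∃ c : ℝ, 0 < c ∧ ∃ n₀ : ℕ, ∀ M N : ℕ, n₀ ≤ M → N ≤ k * M →
      (cornerPercolation t).real (lrCrossing M N) ≤ 1 - c := by
  intro k
  obtain ⟨c, hc, n₀, h⟩ := hLB (k + 2)
  refine ⟨c, hc, n₀ + k + 2, fun M N hM hN => ?_⟩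
  obtain ⟨m, rfl⟩ : ∃ m, M = m + 1 := ⟨M - 1, by omega⟩
  have hm : n₀ ≤ m := by omega
  have hNm : N + 1 ≤ (k + 2) * m := by
    have h1 : k * (m + 1) = k * m + k := by ring
    have h2 : (k + 2) * m = k * m + 2 * m := by ring
    omega
  have hlb : c ≤ (cornerPercolation t).real (lrCrossing (N + 1) m) := h (N + 1) m hm hNm
  have hadd := cornerPercolation_real_lrCrossing_add t m N
  linarith

/-- **Box-crossing bounds for the horizontal crossings of `√2 ℤ²` under `M_t`, for a fixed `t`.**
If for every `k` there are `c > 0`, `n₀` with `c ≤ M_t(LR([0, M] × [0, N]))` whenever `N ≥ n₀`,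
`M ≤ k N`, and with `M_t(LR([0, M] × [0, N])) ≤ 1 - c` whenever `M ≥ n₀`, `N ≤ k M`, then for
every aspect ratio `ρ > 0` there are `c > 0` and `n₀` such that for all `n ≥ n₀` and all
translations `w`, the Euclidean rectangle `w + [0, ρ n] × [0, n]` is crossed horizontally by
`√2 ℤ²` with `M_t`-probability in `[c, 1 - c]`. Sandwich: the embedded crossing event contains the
left–right crossing of a lattice rectangle of `≈ (ρ n/√2 + 2) × (n/√2 - 2)` sites (aspect ratio
`≤ ⌈ρ⌉₊ + 1` once `n ≥ 4 (⌈ρ⌉₊ + 1) + 6`) and is `M_t`-a.s. contained in that of a lattice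
rectangle of `≈ (ρ n/√2) × (n/√2)` sites (inverse aspect ratio `≤ ⌈ρ⁻¹⌉₊ + 1`); `n₀` is taken so
large that the heights/widths of these rectangles exceed the thresholds of the hypotheses.
Pointwise copy of `cornerPercolation_embRectCrossing_bounds`.
(Grimmett–Manolescu 2014, §2.3, for `P_{1/2}`: `square_embRectCrossing_bounds`.)
[cite: GrimmettManolescu2014, §2.3] -/
theorem pointwise_embRectCrossing_bounds (t : unitInterval)
    (hLB : ∀ k : ℕ, ∃ c : ℝ, 0 < c ∧ ∃ n₀ : ℕ, ∀ M N : ℕ, n₀ ≤ N →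
      M ≤ k * N → c ≤ (cornerPercolation t).real (lrCrossing M N))
    (hUB : ∀ k : ℕ, ∃ c : ℝ, 0 < c ∧ ∃ n₀ : ℕ, ∀ M N : ℕ, n₀ ≤ M →
      N ≤ k * M → (cornerPercolation t).real (lrCrossing M N) ≤ 1 - c)
    {ρ : ℝ} (hρ : 0 < ρ) :
    ∃ c > 0, ∃ n₀ : ℕ, ∀ n : ℕ, n₀ ≤ n → ∀ w : ℂ,
      c ≤ (cornerPercolation t).real
          (embRectCrossing (fun v => squareLatticeEmbedding.z v - w) (ρ * n) n) ∧
        (cornerPercolation t).real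
          (embRectCrossing (fun v => squareLatticeEmbedding.z v - w) (ρ * n) n) ≤ 1 - c := by
  obtain ⟨c₁, hc₁, n₁, h₁⟩ := hLB (⌈ρ⌉₊ + 1)
  obtain ⟨c₂, hc₂, n₂, h₂⟩ := hUB (⌈ρ⁻¹⌉₊ + 1)
  refine ⟨min c₁ c₂, lt_min hc₁ hc₂, 4 * (⌈ρ⌉₊ + 1) + 6 + 2 * n₁ + 2 * (⌈ρ⁻¹⌉₊ + 1) * n₂,
    fun n hn w => ?_⟩
  obtain ⟨hs1, hs2⟩ := one_lt_sqrt_two_and_lt_two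
  have hs0 : 0 < Real.sqrt 2 := by linarith
  -- the aspect-ratio constants
  set k₁ : ℕ := ⌈ρ⌉₊ + 1 with hk₁
  set k₂ : ℕ := ⌈ρ⁻¹⌉₊ + 1 with hk₂
  have hk₁ρ : ρ + 1 ≤ k₁ := by
    have := Nat.le_ceil ρ
    simp only [hk₁, Nat.cast_add, Nat.cast_one]; linarith
  have hk₂ρ : ρ⁻¹ ≤ k₂ := by
    have := Nat.le_ceil ρ⁻¹
    simp only [hk₂, Nat.cast_add, Nat.cast_one]; linarith
  have hnr : ((4 * k₁ + 6 + 2 * n₁ + 2 * k₂ * n₂ : ℕ) : ℝ) ≤ n := by exact_mod_cast hn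
  push_cast at hnr
  have hn₁0 : (0 : ℝ) ≤ n₁ := Nat.cast_nonneg _
  have hn₂0 : (0 : ℝ) ≤ n₂ := Nat.cast_nonneg _
  have hk₂0 : (0 : ℝ) ≤ k₂ := Nat.cast_nonneg _
  have hk₂n₂ : (0 : ℝ) ≤ k₂ * n₂ := mul_nonneg hk₂0 hn₂0
  have hn' : (4 * k₁ + 6 : ℝ) ≤ n := by linarith
  have hk₁1 : (1 : ℝ) ≤ k₁ := by exact_mod_cast (show 1 ≤ k₁ by omega)
  have hρn : 0 < ρ * n := mul_pos hρ (by linarith)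
  -- the lattice rectangle read off from `w`
  set iL : ℤ := ⌊w.re / Real.sqrt 2⌋ with hiLdef
  set iR : ℤ := ⌈(w.re + ρ * n) / Real.sqrt 2⌉ with hiRdef
  set jB : ℤ := ⌈w.im / Real.sqrt 2⌉ with hjBdef
  set jT : ℤ := ⌊(w.im + n) / Real.sqrt 2⌋ with hjTdef
  have eL1 : Real.sqrt 2 * iL ≤ w.re := by
    have := Int.floor_le (w.re / Real.sqrt 2)
    rw [le_div_iff₀ hs0] at this; linarith
  have eL2 : w.re < Real.sqrt 2 * iL + Real.sqrt 2 := by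
    have := Int.lt_floor_add_one (w.re / Real.sqrt 2)
    rw [div_lt_iff₀ hs0] at this; linarith
  have eR1 : w.re + ρ * n ≤ Real.sqrt 2 * iR := by
    have := Int.le_ceil ((w.re + ρ * n) / Real.sqrt 2)
    rw [div_le_iff₀ hs0] at this; linarith
  have eR2 : Real.sqrt 2 * iR < w.re + ρ * n + Real.sqrt 2 := by
    have h := Int.ceil_lt_add_one ((w.re + ρ * n) / Real.sqrt 2)
    have h' : (iR : ℝ) - 1 < (w.re + ρ * n) / Real.sqrt 2 := by linarith
    rw [lt_div_iff₀ hs0] at h'; linarith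
  have eB1 : w.im ≤ Real.sqrt 2 * jB := by
    have := Int.le_ceil (w.im / Real.sqrt 2)
    rw [div_le_iff₀ hs0] at this; linarith
  have eB2 : Real.sqrt 2 * jB < w.im + Real.sqrt 2 := by
    have h := Int.ceil_lt_add_one (w.im / Real.sqrt 2)
    have h' : (jB : ℝ) - 1 < w.im / Real.sqrt 2 := by linarith
    rw [lt_div_iff₀ hs0] at h'; linarith
  have eT1 : Real.sqrt 2 * jT ≤ w.im + n := by
    have := Int.floor_le ((w.im + n) / Real.sqrt 2)
    rw [le_div_iff₀ hs0] at this; linarith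
  have eT2 : w.im + n < Real.sqrt 2 * jT + Real.sqrt 2 := by
    have := Int.lt_floor_add_one ((w.im + n) / Real.sqrt 2)
    rw [div_lt_iff₀ hs0] at this; linarith
  -- integer consequences
  have hLR' : (iL : ℝ) < iR := lt_of_mul_lt_mul_left (by linarith) hs0.le
  have hLR : iL < iR := by exact_mod_cast hLR'
  have hBT' : (jB : ℝ) + 1 < jT := lt_of_mul_lt_mul_left (by linarith) hs0.le
  have hBT : jB + 1 < jT := by exact_mod_cast hBT'
  set M : ℕ := (iR - iL).toNat with hMdef
  set N : ℕ := (jT - jB).toNat with hNdef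
  have hM : (M : ℤ) = iR - iL := Int.toNat_of_nonneg (by omega)
  have hN : (N : ℤ) = jT - jB := Int.toNat_of_nonneg (by omega)
  have hMr : (M : ℝ) = iR - iL := by exact_mod_cast hM
  have hNr : (N : ℝ) = jT - jB := by exact_mod_cast hN
  -- the sizes of the lattice rectangles (all estimates are linear in the monomials)
  have hMρ : ρ * n ≤ Real.sqrt 2 * M := by rw [hMr]; linarith
  have hM2 : Real.sqrt 2 * M < ρ * n + 2 * Real.sqrt 2 := by rw [hMr]; linarith
  have hNn : (n : ℝ) - 2 * Real.sqrt 2 < Real.sqrt 2 * N := by rw [hNr]; linarith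
  have hN2 : Real.sqrt 2 * N ≤ n := by rw [hNr]; linarith
  have hk : 1 ≤ (k₂ : ℝ) * ρ := by
    have := mul_le_mul_of_nonneg_right hk₂ρ hρ.le
    rwa [inv_mul_cancel₀ hρ.ne'] at this
  -- `n₁ ≤ N` and `n₂ ≤ M`
  have hN₁ : n₁ ≤ N := by
    have hc : Real.sqrt 2 * n₁ ≤ 2 * n₁ := mul_le_mul_of_nonneg_right hs2.le hn₁0
    have h : (n₁ : ℝ) < N := lt_of_mul_lt_mul_left (by linarith) hs0.le
    exact_mod_cast h.le
  have hM₂ : n₂ ≤ M := by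
    have hA : ρ * (2 * k₂ * n₂) ≤ ρ * n := mul_le_mul_of_nonneg_left (by linarith) hρ.le
    have hB : (n₂ : ℝ) ≤ k₂ * ρ * n₂ := le_mul_of_one_le_left hn₂0 hk
    have hC : Real.sqrt 2 * n₂ ≤ 2 * n₂ := mul_le_mul_of_nonneg_right hs2.le hn₂0
    have h : (n₂ : ℝ) ≤ M := le_of_mul_le_mul_left (by linarith) hs0
    exact_mod_cast h
  -- `M ≤ k₁ N` and `N ≤ k₂ M`
  have hMN : M ≤ k₁ * N := by
    have hp1 : (k₁ : ℝ) * (n - 2 * Real.sqrt 2) ≤ k₁ * (Real.sqrt 2 * N) :=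
      mul_le_mul_of_nonneg_left hNn.le (by linarith)
    have hp2 : (0 : ℝ) ≤ (k₁ - ρ - 1) * n := mul_nonneg (by linarith) (Nat.cast_nonneg n)
    have hp3 : Real.sqrt 2 * k₁ ≤ 2 * k₁ := mul_le_mul_of_nonneg_right hs2.le (by linarith)
    have h3 : (M : ℝ) < k₁ * N := lt_of_mul_lt_mul_left (by linarith) hs0.le
    exact_mod_cast h3.le
  have hNM : N ≤ k₂ * M := by
    have hq1 : (k₂ : ℝ) * (ρ * n) ≤ k₂ * (Real.sqrt 2 * M) := mul_le_mul_of_nonneg_left hMρ hk₂0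
    have hq2 : (0 : ℝ) ≤ (k₂ * ρ - 1) * n := mul_nonneg (by linarith) (Nat.cast_nonneg n)
    have h3 : (N : ℝ) ≤ k₂ * M := le_of_mul_le_mul_left (by linarith) hs0
    exact_mod_cast h3
  constructor
  · calc min c₁ c₂ ≤ c₁ := min_le_left _ _
      _ ≤ (cornerPercolation t).real (lrCrossing M N) := h₁ M N hN₁ hMN
      _ ≤ _ := by
        refine cornerPercolation_real_lrCrossing_le_real_embRectCrossing t w (ρ * n) n iL jB M N
          eL1 (by linarith) ?_ ?_ eB1 ?_
        · rw [hMr]; linarith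
        · rw [hMr]; linarith
        · rw [hNr]; linarith
  · calc _ ≤ (cornerPercolation t).real (lrCrossing M N) := by
          refine cornerPercolation_real_embRectCrossing_le_real_lrCrossing t w (ρ * n) n
            iL iR jB jT ?_ ?_ hLR.le ?_ ?_
          · intro s hs
            rw [hiLdef, Int.le_floor, le_div_iff₀ hs0]; linarith
          · intro s hs
            rw [hiRdef, Int.ceil_le, div_le_iff₀ hs0]; linarith
          · intro s hs
            rw [hjBdef, Int.ceil_le, div_le_iff₀ hs0]; linarith
          · intro s hs
            rw [hjTdef, Int.le_floor, le_div_iff₀ hs0]; linarith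
      _ ≤ 1 - c₂ := h₂ M N hM₂ hNM
      _ ≤ 1 - min c₁ c₂ := by linarith [min_le_right c₁ c₂]

/-- **Stub `stub_pointwiseRender` (Target ⇒ pointwise box crossing).** For a fixed `t ∈ [0, 1]`,
lower bounds `c ≤ M_t(LR([0, M] × [0, N]))` for lattice rectangles of every bounded aspect ratio
(`N ≥ n₀`, `M ≤ k N`) give the box-crossing property of `M_t = cornerPercolation t` drawn as
`√2 ℤ²`: upper bounds by self-duality (`pointwise_upper`), the embedded horizontal crossings of
`w + [0, ρ n] × [0, n]` by the `√2 ℤ²` sandwich (`pointwise_embRectCrossing_bounds`), and the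
vertical crossings by the transposition symmetry
(`cornerPercolation_real_embTBCrossing_eq_real_embRectCrossing`). Pointwise copy of
`stub_upper` + `stub_render` of crux `UniformBoxCrossing`.
(Grimmett–Manolescu 2014, §2.3, for `P_{1/2}`.) [cite: GrimmettManolescu2014, §2.3] -/
theorem stub_pointwiseRender : ∀ (t : unitInterval), (∀ k : ℕ, ∃ c : ℝ, 0 < c ∧ ∃ n₀ : ℕ, ∀ M N : ℕ, n₀ ≤ N → M ≤ k * N → c ≤ (cornerPercolation t).real (lrCrossing M N)) → HasBoxCrossingProperty (cornerPercolation t) squareLatticeEmbedding.z := by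
  intro t hLB ρ hρ
  obtain ⟨c, hc, n₀, h⟩ := pointwise_embRectCrossing_bounds t hLB (pointwise_upper t hLB) hρ
  refine ⟨c, hc, n₀, fun n hn w => ⟨h n hn w, ?_⟩⟩
  rw [cornerPercolation_real_embTBCrossing_eq_real_embRectCrossing]
  exact h n hn _

end Summit.CriticalPhenomena.CardyFormulaZ2.Cruxes.UniformMarginality.HeatFlow

end
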